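import Summits.NavierStokesRegularity.NavierStokesRegularity.Theorems.TypeICertificateLadderStrainRateMaxPrincipleNonneg
import Summits.NavierStokesRegularity.NavierStokesRegularity.Theorems.TypeICertificateLadderStrainRateWeightedVorticity
import Literature.Analysis.FluidPDE.NSVorticityBKMHolds
import Literature.Analysis.FluidPDE.PutativeSelfSimilarEulerProofs
import HarnessLib

/-!
# Route TypeICertificateLadder — the explicit strain-rate constant `1` at a singular time, for
  EULER and Navier–Stokes uniformly (`ν ≥ 0`; C32 of cell pub-ns-dss; helper of crux
  stmt-NavierStokesRegularity-2882)

`TypeICertificateLadderStrainRateThresholdOne.lean` proves C32 for `ν > 0` (time rescaling by `ν` in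
the tree's maximum principle). No diffusion is needed: with the `ν ≥ 0` maximum principle
`le_of_subsolution_linear_drift_of_nonneg`, the Kato computation `strainWeight_algebra` (valid for
`ν ≥ 0`, and using ONLY the stretching rate along the vorticity) and the tree's Beale–Kato–Majda
criterion (`beale_kato_majda_holds`, `ν ≥ 0`) give the aligned form for Euler and Navier–Stokes —
sharpening Chae's theorem (J. Funct. Anal. 2010, Thm 1.1: `limsup_{t↑T} (T − t)‖∇v(t)‖_∞ ≥ 1` past a
non-continuable time of an `H^m` Euler solution, `m > 5/2`; here the `H^∞` BKM sub-class).

* `weightedVorticity_le_of_alignedStretching_bound` — `(T − t)^{2θ}‖ω‖² ≤ M` on `[t₀, T)` under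
  the ALIGNED bound `(T − t)⟪∇u ω, ω⟫ ≤ θ|ω|²` on `(t₀, T)`, `ν ≥ 0` (only the stretching rate along
  the vorticity enters Kato's identity).
* `alignedStretching_frequently_gt_of_not_hasSobolevExtensionPast` — `ν ≥ 0`: at a singular time,
  `θ|ω|² < (T − t)⟪∇u ω, ω⟫` somewhere, frequently, for every `θ < 1`.
* `strainRate_frequently_gt_of_not_hasSobolevExtensionPast_of_nonneg` — C32 for `ν ≥ 0`;
  `euler_alignedStretching_frequently_gt_…` (Euler, Chae's `α = ξ·Sξ` on the vortex set),
  `gradRate_frequently_gt_of_not_hasSobolevExtensionPast` (`ν ≥ 0`, Chae's printed `‖∇u‖_∞` form).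

HONEST FRAMING: statements about a HYPOTHETICAL singular time; no such solution is asserted to
exist; `1` is the threshold of this elementary argument, nothing is said at or above it; nothing here
bears on the regularity question itself. Lands `--supports stmt-NavierStokesRegularity-2882`. -/

noncomputable section

namespace Summit.NavierStokesRegularity.NavierStokesRegularity.Theorems

set_option linter.dupNamespace false

open MeasureTheory Set Filter Topology Function
open scoped RealInnerProductSpace Laplacian ContDiff
open Literature.Analysis Literature.Analysis.FluidPDE

/-! ### The weighted vorticity bound, `ν ≥ 0` -/

/-- **`(T − t)^{2θ}‖ω(t,x)‖² ≤ (T − t₀)^{2θ} sup‖ω(t₀)‖²` on `[t₀, T)` under the ALIGNED stretching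
bound.** Let `(u, p)` be a classical solution of unforced Euler (`ν = 0`) or Navier–Stokes (`ν > 0`)
on `ℝ³ × [0,T)` in the BKM class on every `[0,T'']`, `T'' < T`, and suppose the stretching rate ALONG
THE VORTICITY satisfies `(T − t)⟪∇u(t,x) ω, ω⟫ ≤ θ|ω|²` (i.e. `(T − t) ξ·Sξ ≤ θ` wherever `ω ≠ 0`,
`ξ = ω/|ω|`) for all `x` and all `t ∈ (t₀, T)` (`0 < t₀ < T`, `0 ≤ θ`). Then `P = (T − t)^{2θ}|ω|²` is bounded on `[t₀, T) × ℝ³` by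
`M = (T − t₀)^{2θ} B₀²`, `B₀ = sup‖ω(t₀)‖`: `P` is a bounded (Sobolev sup bounds,
`exists_forall_norm_iteratedFDeriv_le_bkmClass`) subsolution of `∂ₜP ≤ νΔP + ‖u‖_∞‖∇P‖` on every
`[t₀, T₂]`, `T₂ < T` (`strainWeight_algebra` on the vorticity equation
`IsClassicalNSSolutionOn.isVorticitySolutionOn_zero_force`), and `le_of_subsolution_linear_drift_of_nonneg`
applies (no diffusion is needed). [folklore] -/
theorem weightedVorticity_le_of_alignedStretching_bound {ν T θ t₀ : ℝ} (hν : 0 ≤ ν) (hθ : 0 ≤ θ)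
    (ht₀ : 0 < t₀) (ht₀T : t₀ < T)
    {u : ℝ → EuclideanSpace ℝ (Fin 3) → EuclideanSpace ℝ (Fin 3)}
    {p : ℝ → EuclideanSpace ℝ (Fin 3) → ℝ}
    (hsol : IsClassicalNSSolutionOn (Ico 0 T) ν 0 u p)
    (hreg : ∀ T'' < T, HasBoundedSobolevNormsOn (Icc 0 T'') u)
    (hstretch : ∀ t ∈ Ioo t₀ T, ∀ x,
      (T - t) * ⟪fderiv ℝ (u t) x (curl (u t) x), curl (u t) x⟫ ≤ θ * ‖curl (u t) x‖ ^ 2) :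
    ∃ M : ℝ, ∀ t ∈ Ico t₀ T, ∀ x, (T - t) ^ (2 * θ) * ‖curl (u t) x‖ ^ 2 ≤ M := by
  -- the solution on the open slab and its vorticity equation (two-sided time derivative)
  have hsolo : IsClassicalNSSolutionOn (Ioo 0 T) ν 0 u p :=
    hsol.mono Ioo_subset_Ico_self isOpen_Ioo.uniqueDiffOn
  have hsm : IsSmoothSpaceTimeOn (Ioo 0 T) u := hsolo.smooth_velocity
  have hvort : IsSmoothSpaceTimeOn (Ioo 0 T) (vorticity u) := by
    have h1 := (hsm.isSmoothSpaceTimeOn_fderiv_of_isOpen isOpen_Ioo).clm curlCLM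
    have e : (fun t x => curlCLM (fderiv ℝ (u t) x)) = vorticity u := by funext s y; rfl
    rwa [e] at h1
  have hV := hsolo.isVorticitySolutionOn_zero_force isOpen_Ioo.uniqueDiffOn
    (by rw [interior_Ioo]; exact subset_closure)
  have hveq : ∀ t ∈ Ioo 0 T, ∀ x,
      deriv (fun s => curl (u s) x) t + fderiv ℝ (curl (u t)) x (u t x) =
        fderiv ℝ (u t) x (curl (u t) x) + ν • (Δ (curl (u t))) x := by
    intro t ht x
    have h := hV.vorticity_eq t ht x
    simp only [timeDerivWithin_eq_deriv isOpen_Ioo ht, convect_apply, vorticity_apply] at h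
    exact h
  -- smoothness of the slices
  have hsmooth : ∀ t ∈ Ico 0 T, ContDiff ℝ ∞ (u t) := fun t ht => hsol.contDiff_velocity ht
  -- the bound at the initial time `t₀`
  obtain ⟨B₁, hB₁0, hB₁⟩ := exists_forall_norm_iteratedFDeriv_le_bkmClass
    (fun t ht => hsmooth t ⟨ht.1, ht.2.trans_lt ht₀T⟩) (hreg t₀ ht₀T) 1
  set κ₀ : ℝ := ‖(curlCLM : (EuclideanSpace ℝ (Fin 3) →L[ℝ] EuclideanSpace ℝ (Fin 3)) →L[ℝ]
    EuclideanSpace ℝ (Fin 3))‖ with hκ₀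
  have hκ₀0 : 0 ≤ κ₀ := by rw [hκ₀]; positivity
  have hcurl_le : ∀ (f : EuclideanSpace ℝ (Fin 3) → EuclideanSpace ℝ (Fin 3)) (x),
      ‖curl f x‖ ≤ κ₀ * ‖iteratedFDeriv ℝ 1 f x‖ := fun f x => by
    rw [curl_eq_curlCLM, ← norm_iteratedFDeriv_fderiv, norm_iteratedFDeriv_zero]
    exact ContinuousLinearMap.le_opNorm _ _
  set M : ℝ := (T - t₀) ^ (2 * θ) * (κ₀ * B₁) ^ 2 with hMdef
  refine ⟨M, fun t ht x => ?_⟩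
  have hω₀ : ∀ y, ‖curl (u t₀) y‖ ≤ κ₀ * B₁ := fun y =>
    (hcurl_le _ y).trans (mul_le_mul_of_nonneg_left (hB₁ t₀ ⟨ht₀.le, le_rfl⟩ y) hκ₀0)
  have hPt₀ : ∀ y, (T - t₀) ^ (2 * θ) * ‖curl (u t₀) y‖ ^ 2 ≤ M := fun y => by
    rw [hMdef]
    refine mul_le_mul_of_nonneg_left ?_ (Real.rpow_nonneg (sub_pos.2 ht₀T).le _)
    exact pow_le_pow_left₀ (norm_nonneg _) (hω₀ y) 2
  rcases ht.1.eq_or_lt with rfl | ht₀t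
  · exact hPt₀ x
  -- the maximum principle on `[t₀, T₂]`, `T₂ = t`
  set T₂ : ℝ := t with hT₂
  have hT₂T : T₂ < T := ht.2
  -- uniform bounds on `[0, T₂]`: `‖u‖ ≤ K`, `‖ω‖ ≤ κ₀ B₂`
  obtain ⟨K, hK0, hK⟩ := exists_forall_norm_iteratedFDeriv_le_bkmClass
    (fun s hs => hsmooth s ⟨hs.1, hs.2.trans_lt hT₂T⟩) (hreg T₂ hT₂T) 0
  obtain ⟨B₂, hB₂0, hB₂⟩ := exists_forall_norm_iteratedFDeriv_le_bkmClass
    (fun s hs => hsmooth s ⟨hs.1, hs.2.trans_lt hT₂T⟩) (hreg T₂ hT₂T) 1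
  have huK : ∀ s ∈ Icc 0 T₂, ∀ y, ‖u s y‖ ≤ K := fun s hs y => by
    have h := hK s hs y
    rwa [norm_iteratedFDeriv_zero] at h
  have hωB : ∀ s ∈ Icc 0 T₂, ∀ y, ‖curl (u s) y‖ ≤ κ₀ * B₂ := fun s hs y =>
    (hcurl_le _ y).trans (mul_le_mul_of_nonneg_left (hB₂ s hs y) hκ₀0)
  -- the weighted density and its time derivative
  set P : ℝ → EuclideanSpace ℝ (Fin 3) → ℝ :=
    fun s y => (T - s) ^ (2 * θ) * ‖curl (u s) y‖ ^ 2 with hPdef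
  set Pₜ : ℝ → EuclideanSpace ℝ (Fin 3) → ℝ := fun s y =>
    (-1) * (2 * θ) * (T - s) ^ (2 * θ - 1) * ‖curl (u s) y‖ ^ 2 +
      (T - s) ^ (2 * θ) * (2 * ⟪curl (u s) y, deriv (fun σ => curl (u σ) y) s⟫) with hPₜdef
  have hIoc_sub : ∀ {s}, s ∈ Ioc t₀ T₂ → s ∈ Ioo 0 T := fun {s} hs =>
    ⟨ht₀.trans hs.1, hs.2.trans_lt hT₂T⟩
  have hIcc_sub : ∀ {s}, s ∈ Icc t₀ T₂ → s ∈ Ioo 0 T := fun {s} hs =>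
    ⟨ht₀.trans_le hs.1, hs.2.trans_lt hT₂T⟩
  have key := le_of_subsolution_linear_drift_of_nonneg (T₁ := t₀) (T₂ := T₂) (M := M)
    (B := T ^ (2 * θ) * (κ₀ * B₂) ^ 2) (K := K) (P := P) (Pₜ := Pₜ) hν hK0 ?_ ?_ ?_ ?_ ?_ ?_
  · exact key t ⟨ht₀t.le, le_rfl⟩ x
  · -- joint continuity on `[t₀, T₂] × ℝ³`
    have hw : Continuous fun z : ℝ × EuclideanSpace ℝ (Fin 3) => (T - z.1) ^ (2 * θ) :=
      (continuous_const.sub continuous_fst).rpow_const fun _ => Or.inr (by positivity)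
    have hωc : ContinuousOn (fun z : ℝ × EuclideanSpace ℝ (Fin 3) => ‖vorticity u z.1 z.2‖ ^ 2)
        (Icc t₀ T₂ ×ˢ univ) := by
      refine ((hvort.continuousOn.mono ?_).norm).pow 2
      exact prod_mono (fun s hs => hIcc_sub hs) subset_rfl
    refine (hw.continuousOn.mul hωc).congr fun z _ => ?_
    simp only [hPdef, uncurry, Pi.mul_apply, vorticity_apply]
  · -- `C²` slices
    intro s hs
    have hω : ContDiff ℝ 2 (curl (u s)) := by
      rw [← vorticity_apply]
      exact (hvort.contDiff_slice (hIoc_sub hs)).of_le (by norm_cast)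
    exact contDiff_const.mul (hω.norm_sq ℝ)
  · -- time derivative
    intro s hs y
    have hs' := hIoc_sub hs
    have hTs : 0 < T - s := sub_pos.2 hs'.2
    have hw : HasDerivAt (fun σ => (T - σ) ^ (2 * θ)) ((-1) * (2 * θ) * (T - s) ^ (2 * θ - 1)) s := by
      have h := ((hasDerivAt_id s).const_sub T).rpow_const (p := 2 * θ) (Or.inl hTs.ne')
      simpa using h
    have hωt : HasDerivAt (fun σ => curl (u σ) y) (deriv (fun σ => curl (u σ) y) s) s := by
      have h := hvort.hasDerivAt_timeLine isOpen_Ioo hs' y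
      simpa only [vorticity_apply] using h
    exact hw.mul hωt.norm_sq
  · -- the subsolution inequality
    intro s hs y
    have hs' := hIoc_sub hs
    have hTs : 0 < T - s := sub_pos.2 hs'.2
    have hω2 : ContDiff ℝ 2 (curl (u s)) := by
      rw [← vorticity_apply]
      exact (hvort.contDiff_slice hs').of_le (by norm_cast)
    have hωd : DifferentiableAt ℝ (curl (u s)) y := (hω2.differentiable (by norm_num)) y
    -- the slice `P s` is `c • |ω|²`
    set c : ℝ := (T - s) ^ (2 * θ) with hcdef
    have hc0 : 0 ≤ c := Real.rpow_nonneg hTs.le _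
    have hF2 : ContDiff ℝ 2 (fun z => ‖curl (u s) z‖ ^ 2) := hω2.norm_sq ℝ
    have hPs : P s = c • fun z => ‖curl (u s) z‖ ^ 2 := by
      funext z; simp only [hPdef, Pi.smul_apply, smul_eq_mul, hcdef]
    have hLap : (Δ (P s)) y = c * (2 * ⟪(Δ (curl (u s))) y, curl (u s) y⟫ +
        2 * frobeniusNormSq (fderiv ℝ (curl (u s)) y)) := by
      rw [hPs, InnerProductSpace.laplacian_smul c (hF2.contDiffAt), smul_eq_mul,
        laplacian_norm_sq_comp hω2 y]
    have hgrad : ∀ w, fderiv ℝ (P s) y w = c * (2 * ⟪curl (u s) y, fderiv ℝ (curl (u s)) y w⟫) := by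
      intro w
      rw [hPs, fderiv_const_smul ((hF2.differentiable (by norm_num)) y),
        FunLike.coe_smul, Pi.smul_apply, smul_eq_mul, fderiv_norm_sq_comp_apply hωd w]
    -- the strain bound in the form `⟪Du ω, ω⟫ ≤ (θ/(T−s)) |ω|²`
    have hκ : ⟪fderiv ℝ (u s) y (curl (u s) y), curl (u s) y⟫ ≤
        θ / (T - s) * ‖curl (u s) y‖ ^ 2 := by
      rw [div_mul_eq_mul_div, le_div_iff₀ hTs, mul_comm]
      exact hstretch s ⟨hs.1, hs'.2⟩ y
    have hc' : (-1) * (2 * θ) * (T - s) ^ (2 * θ - 1) = -(2 * (θ / (T - s))) * c := by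
      rw [hcdef, Real.rpow_sub_one hTs.ne']
      field_simp
    have halg := strainWeight_algebra (hveq s hs' y)
      (frobeniusNormSq_nonneg (fderiv ℝ (curl (u s)) y)) hν hκ hc0 hc'
    -- assemble: `Pₜ ≤ ν ΔP − ∇P·u ≤ ν ΔP + K (1 + ‖y‖) ‖∇P‖`
    have hdrift : -(fderiv ℝ (P s) y (u s y)) ≤ K * (1 + ‖y‖) * ‖fderiv ℝ (P s) y‖ := by
      have h1 : -(fderiv ℝ (P s) y (u s y)) ≤ ‖fderiv ℝ (P s) y‖ * ‖u s y‖ :=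
        (neg_le_abs _).trans ((Real.norm_eq_abs _).symm.le.trans (ContinuousLinearMap.le_opNorm _ _))
      have h2 : ‖fderiv ℝ (P s) y‖ * ‖u s y‖ ≤ ‖fderiv ℝ (P s) y‖ * K :=
        mul_le_mul_of_nonneg_left (huK s ⟨hs'.1.le, hs.2⟩ y) (norm_nonneg _)
      have h3 : ‖fderiv ℝ (P s) y‖ * K ≤ K * (1 + ‖y‖) * ‖fderiv ℝ (P s) y‖ := by
        have : 0 ≤ K * ‖y‖ * ‖fderiv ℝ (P s) y‖ := by positivity
        nlinarith
      linarith
    show Pₜ s y ≤ ν * (Δ (P s)) y + K * (1 + ‖y‖) * ‖fderiv ℝ (P s) y‖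
    rw [hLap]
    have e1 : Pₜ s y = (-1) * (2 * θ) * (T - s) ^ (2 * θ - 1) * ‖curl (u s) y‖ ^ 2 +
        c * (2 * ⟪curl (u s) y, deriv (fun σ => curl (u σ) y) s⟫) := rfl
    rw [e1]
    have e2 := hgrad (u s y)
    linarith [halg, hdrift, e2]
  · -- bounded above on `[t₀, T₂] × ℝ³`
    intro s hs y
    have hs' := hIcc_sub hs
    have hTs : 0 < T - s := sub_pos.2 hs'.2
    have hw : (T - s) ^ (2 * θ) ≤ T ^ (2 * θ) :=
      Real.rpow_le_rpow hTs.le (by linarith [hs'.1]) (by positivity)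
    have hω : ‖curl (u s) y‖ ^ 2 ≤ (κ₀ * B₂) ^ 2 :=
      pow_le_pow_left₀ (norm_nonneg _) (hωB s ⟨hs'.1.le, hs.2⟩ y) 2
    exact mul_le_mul hw hω (sq_nonneg _) (Real.rpow_nonneg (ht₀.le.trans ht₀T.le) _)
  · -- the initial slice
    exact hPt₀

/-! ### Aligned stretching at a singular time, `ν ≥ 0` -/

/-- **Aligned stretching at a singular time, Euler and Navier–Stokes (BKM class, `ν ≥ 0`).** Let
`(u, p)` be a classical solution of the unforced Euler (`ν = 0`) or Navier–Stokes (`ν > 0`) system on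
`ℝ³ × [0,T)`, `T > 0`, with all `L²` Sobolev norms bounded on every `[0,T'']`, `T'' < T`, which cannot
be continued in this class past `T` (`¬ HasSobolevExtensionPast`). Then for every `θ < 1`, frequently
as `t ↑ T`, some point `x` has `θ|ω(t,x)|² < (T − t)⟪∇u(t,x) ω, ω⟫`, i.e. `ω ≠ 0` and the stretching
rate along the vorticity direction `ξ·Sξ = α` exceeds `θ/(T − t)`:
`limsup_{t↑T} (T − t) sup_{ω ≠ 0} α ≥ 1` — the quantity of Chae's proof (JFA 2010 Thm 1.1, Euler),
here for `ν ≥ 0`. Otherwise `weightedVorticity_le_of_alignedStretching_bound` gives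
`‖ω(t)‖_∞ ≤ √M (T − t)^{−θ'}` (`θ' = max θ ½`), integrable on `(0,T)`, and the Beale–Kato–Majda
criterion (`beale_kato_majda_holds`, stated in the tree for `ν ≥ 0`) continues the solution.
[cite: Chae2010, Thm 1.1 (= arXiv:0711.1113 Thm 1.1; the proof's `α = ξ·∇v ξ` form)] -/
theorem alignedStretching_frequently_gt_of_not_hasSobolevExtensionPast {ν T : ℝ} (hν : 0 ≤ ν)
    (hT : 0 < T) {u : ℝ → EuclideanSpace ℝ (Fin 3) → EuclideanSpace ℝ (Fin 3)}
    {p : ℝ → EuclideanSpace ℝ (Fin 3) → ℝ}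
    (hsol : IsClassicalNSSolutionOn (Ico 0 T) ν 0 u p)
    (hreg : ∀ T'' < T, HasBoundedSobolevNormsOn (Icc 0 T'') u)
    (hmax : ¬ HasSobolevExtensionPast ν u T) {θ : ℝ} (hθ : θ < 1) :
    ∃ᶠ t in 𝓝[<] T, ∃ x,
      θ * ‖curl (u t) x‖ ^ 2 < (T - t) * ⟪fderiv ℝ (u t) x (curl (u t) x), curl (u t) x⟫ := by
  by_contra h
  simp only [Filter.not_frequently, not_exists, not_lt] at h
  -- the aligned stretching bound with `θ' = max θ ½ ∈ (0, 1)` on a window `(t₀, T)`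
  set θ' : ℝ := max θ (1 / 2) with hθ'def
  have hθ'0 : 0 < θ' := lt_of_lt_of_le one_half_pos (le_max_right _ _)
  have hθ'1 : θ' < 1 := max_lt hθ (by norm_num)
  have h' : ∀ᶠ t in 𝓝[<] T, ∀ x,
      (T - t) * ⟪fderiv ℝ (u t) x (curl (u t) x), curl (u t) x⟫ ≤ θ' * ‖curl (u t) x‖ ^ 2 :=
    h.mono fun t ht x => (ht x).trans (mul_le_mul_of_nonneg_right (le_max_left _ _) (sq_nonneg _))
  obtain ⟨T₀, hT₀T, hT₀⟩ := mem_nhdsLT_iff_exists_Ioo_subset.1 h'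
  set t₀ : ℝ := max T₀ (T / 2) with ht₀def
  have ht₀T : t₀ < T := max_lt hT₀T (by linarith)
  have ht₀0 : 0 < t₀ := lt_of_lt_of_le (by linarith) (le_max_right _ _)
  have hstretch : ∀ t ∈ Ioo t₀ T, ∀ x,
      (T - t) * ⟪fderiv ℝ (u t) x (curl (u t) x), curl (u t) x⟫ ≤ θ' * ‖curl (u t) x‖ ^ 2 :=
    fun t ht => hT₀ ⟨lt_of_le_of_lt (le_max_left _ _) ht.1, ht.2⟩
  obtain ⟨M, hM⟩ := weightedVorticity_le_of_alignedStretching_bound hν hθ'0.le ht₀0 ht₀T hsol hreg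
    hstretch
  have hM0 : 0 ≤ M := le_trans (mul_nonneg (Real.rpow_nonneg (sub_pos.2 ht₀T).le _) (sq_nonneg _))
    (hM t₀ ⟨le_rfl, ht₀T⟩ 0)
  -- the vorticity bound on `[0, t₀]`
  have hsmooth : ∀ t ∈ Ico 0 T, ContDiff ℝ ∞ (u t) := fun t ht => hsol.contDiff_velocity ht
  obtain ⟨B₁, hB₁0, hB₁⟩ := exists_forall_norm_iteratedFDeriv_le_bkmClass
    (fun t ht => hsmooth t ⟨ht.1, ht.2.trans_lt ht₀T⟩) (hreg t₀ ht₀T) 1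
  set κ₀ : ℝ := ‖(curlCLM : (EuclideanSpace ℝ (Fin 3) →L[ℝ] EuclideanSpace ℝ (Fin 3)) →L[ℝ]
    EuclideanSpace ℝ (Fin 3))‖ with hκ₀
  have hκ₀0 : 0 ≤ κ₀ := by rw [hκ₀]; positivity
  have hcurl_le : ∀ (f : EuclideanSpace ℝ (Fin 3) → EuclideanSpace ℝ (Fin 3)) (x),
      ‖curl f x‖ ≤ κ₀ * ‖iteratedFDeriv ℝ 1 f x‖ := fun f x => by
    rw [curl_eq_curlCLM, ← norm_iteratedFDeriv_fderiv, norm_iteratedFDeriv_zero]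
    exact ContinuousLinearMap.le_opNorm _ _
  -- the pointwise bound `‖ω(t,x)‖ ≤ Kc (T − t)^{−θ'}` on `(0,T) × ℝ³`
  set Kc : ℝ := max (κ₀ * B₁ * T ^ θ') (Real.sqrt M) with hKc
  have hbound : ∀ t ∈ Ioo 0 T, ∀ x, ‖curl (u t) x‖ ≤ Kc * (T - t) ^ (-θ') := by
    intro t ht x
    have hTt : 0 < T - t := sub_pos.2 ht.2
    have hpow : 0 < (T - t) ^ θ' := Real.rpow_pos_of_pos hTt _
    rw [Real.rpow_neg hTt.le, ← div_eq_mul_inv, le_div_iff₀ hpow]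
    rcases lt_or_ge t t₀ with hlt | hge
    · -- before `t₀`: Sobolev sup bound, `(T − t)^θ' ≤ T^θ'`
      have h1 : ‖curl (u t) x‖ ≤ κ₀ * B₁ :=
        (hcurl_le _ x).trans (mul_le_mul_of_nonneg_left (hB₁ t ⟨ht.1.le, hlt.le⟩ x) hκ₀0)
      have h2 : (T - t) ^ θ' ≤ T ^ θ' :=
        Real.rpow_le_rpow hTt.le (by linarith [ht.1]) hθ'0.le
      calc ‖curl (u t) x‖ * (T - t) ^ θ'
          ≤ κ₀ * B₁ * T ^ θ' := mul_le_mul h1 h2 hpow.le (by positivity)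
        _ ≤ Kc := le_max_left _ _
    · -- after `t₀`: the weighted bound `(T − t)^{2θ'}‖ω‖² ≤ M`
      have h1 := hM t ⟨hge, ht.2⟩ x
      have e2 : ((T - t) ^ θ') ^ 2 = (T - t) ^ (2 * θ') := by
        rw [← Real.rpow_two, ← Real.rpow_mul hTt.le]
        congr 1
        ring
      have e : (‖curl (u t) x‖ * (T - t) ^ θ') ^ 2 = (T - t) ^ (2 * θ') * ‖curl (u t) x‖ ^ 2 := by
        rw [mul_pow, e2, mul_comm]
      have h2 : (‖curl (u t) x‖ * (T - t) ^ θ') ^ 2 ≤ M := by rw [e]; exact h1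
      have h3 : ‖curl (u t) x‖ * (T - t) ^ θ' ≤ Real.sqrt M := by
        rw [← Real.sqrt_sq (by positivity : 0 ≤ ‖curl (u t) x‖ * (T - t) ^ θ')]
        exact Real.sqrt_le_sqrt h2
      exact h3.trans (le_max_right _ _)
  -- hence `∫₀ᵀ ‖ω(t)‖_{L^∞} dt < ∞`, and BKM continues the solution past `T`
  have hfin : (∫⁻ t in Ioo 0 T, ⨆ x, ‖curl (u t) x‖ₑ) < ⊤ := by
    refine lt_of_le_of_lt (setLIntegral_mono' measurableSet_Ioo fun t ht => ?_)
      (CIV2026.lintegral_Ioo_rpow_neg_lt_top Kc hθ'1)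
    refine iSup_le fun x => ?_
    rw [← ofReal_norm]
    exact ENNReal.ofReal_le_ofReal (hbound t ht x)
  exact hmax ((beale_kato_majda_holds hν hT hsol hreg).2 hfin)

/-! ### Corollaries: the strain form for `ν ≥ 0`, and the Euler case -/

/-- **C32 for `ν ≥ 0` (all directions).** Under the hypotheses of
`alignedStretching_frequently_gt_of_not_hasSobolevExtensionPast`: for every `θ < 1`, frequently as
`t ↑ T`, `θ‖ξ‖² < (T − t)⟪∇u(t,x) ξ, ξ⟫` for some `x, ξ` (take `ξ = ω(t,x)`); for `ν > 0` this is
`strainRate_frequently_gt_of_not_hasSobolevExtensionPast`, here also for Euler. [this file] -/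
theorem strainRate_frequently_gt_of_not_hasSobolevExtensionPast_of_nonneg {ν T : ℝ} (hν : 0 ≤ ν)
    (hT : 0 < T) {u : ℝ → EuclideanSpace ℝ (Fin 3) → EuclideanSpace ℝ (Fin 3)}
    {p : ℝ → EuclideanSpace ℝ (Fin 3) → ℝ}
    (hsol : IsClassicalNSSolutionOn (Ico 0 T) ν 0 u p)
    (hreg : ∀ T'' < T, HasBoundedSobolevNormsOn (Icc 0 T'') u)
    (hmax : ¬ HasSobolevExtensionPast ν u T) {θ : ℝ} (hθ : θ < 1) :
    ∃ᶠ t in 𝓝[<] T, ∃ x ξ : EuclideanSpace ℝ (Fin 3),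
      θ * ‖ξ‖ ^ 2 < (T - t) * ⟪fderiv ℝ (u t) x ξ, ξ⟫ :=
  (alignedStretching_frequently_gt_of_not_hasSobolevExtensionPast hν hT hsol hreg hmax hθ).mono
    fun t ⟨x, hx⟩ => ⟨x, curl (u t) x, hx⟩

/-- **The Euler case in Chae's variables: `θ < (T − t) α(t,x)` at a point of the vortex set,
frequently, for every `θ < 1`** (`α = ⟪∇u ξ, ξ⟫`, `ξ = ω/|ω|` the vorticity direction), for a
classical Euler solution on `ℝ³ × [0,T)` with all `L²` Sobolev norms bounded on every `[0,T'']`,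
`T'' < T`, that cannot be continued in this class past `T`.
[cite: Chae2010, Thm 1.1 (= arXiv:0711.1113 Thm 1.1; the proof's `α = ξ·∇v ξ` form)] -/
theorem euler_alignedStretching_frequently_gt_of_not_hasSobolevExtensionPast {T : ℝ} (hT : 0 < T)
    {u : ℝ → EuclideanSpace ℝ (Fin 3) → EuclideanSpace ℝ (Fin 3)}
    {p : ℝ → EuclideanSpace ℝ (Fin 3) → ℝ}
    (hsol : IsClassicalEulerSolutionOn (Ico 0 T) 0 u p)
    (hreg : ∀ T'' < T, HasBoundedSobolevNormsOn (Icc 0 T'') u)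
    (hmax : ¬ HasSobolevExtensionPast 0 u T) {θ : ℝ} (hθ : θ < 1) :
    ∃ᶠ t in 𝓝[<] T, ∃ x, curl (u t) x ≠ 0 ∧
      θ < (T - t) * ⟪fderiv ℝ (u t) x (vorticityDirection (curl (u t)) x),
        vorticityDirection (curl (u t)) x⟫ := by
  have hev : ∀ᶠ t in 𝓝[<] T, t < T := eventually_nhdsWithin_of_forall fun t ht => ht
  refine ((alignedStretching_frequently_gt_of_not_hasSobolevExtensionPast le_rfl hT hsol hreg hmax
    hθ).and_eventually hev).mono fun t ht => ?_
  obtain ⟨⟨x, hx⟩, htT⟩ := ht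
  have hω : curl (u t) x ≠ 0 := by
    intro h0
    rw [h0] at hx
    simp at hx
  refine ⟨x, hω, ?_⟩
  have hn : 0 < ‖curl (u t) x‖ := norm_pos_iff.2 hω
  have hn2 : 0 < ‖curl (u t) x‖ ^ 2 := by positivity
  -- `⟪∇u ω, ω⟫ = |ω|² ⟪∇u ξ, ξ⟫`
  have e : ⟪fderiv ℝ (u t) x (curl (u t) x), curl (u t) x⟫ =
      ‖curl (u t) x‖ ^ 2 * ⟪fderiv ℝ (u t) x (vorticityDirection (curl (u t)) x),
        vorticityDirection (curl (u t)) x⟫ := by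
    rw [vorticityDirection_apply, map_smul, real_inner_smul_left, real_inner_smul_right]
    field_simp
  rw [e] at hx
  have hx' : θ * ‖curl (u t) x‖ ^ 2 <
      ((T - t) * ⟪fderiv ℝ (u t) x (vorticityDirection (curl (u t)) x),
        vorticityDirection (curl (u t)) x⟫) * ‖curl (u t) x‖ ^ 2 := by
    linarith
  exact lt_of_mul_lt_mul_right hx' hn2.le

/-- **Chae's form, Euler and Navier–Stokes (`ν ≥ 0`): `θ < (T − t)‖∇u(t,x)‖` frequently, for every
`θ < 1`** (so `limsup_{t↑T} (T − t)‖∇u(t)‖_∞ ≥ 1` at a time past which the BKM-class solution cannot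
be continued; Chae 2010 Thm 1.1 is the Euler case), from the aligned form by `⟪∇u ω, ω⟫ ≤ ‖∇u‖|ω|²`.
[cite: Chae2010, Thm 1.1 (= arXiv:0711.1113 Thm 1.1)] -/
theorem gradRate_frequently_gt_of_not_hasSobolevExtensionPast {ν T : ℝ} (hν : 0 ≤ ν)
    (hT : 0 < T) {u : ℝ → EuclideanSpace ℝ (Fin 3) → EuclideanSpace ℝ (Fin 3)}
    {p : ℝ → EuclideanSpace ℝ (Fin 3) → ℝ}
    (hsol : IsClassicalNSSolutionOn (Ico 0 T) ν 0 u p)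
    (hreg : ∀ T'' < T, HasBoundedSobolevNormsOn (Icc 0 T'') u)
    (hmax : ¬ HasSobolevExtensionPast ν u T) {θ : ℝ} (hθ : θ < 1) :
    ∃ᶠ t in 𝓝[<] T, ∃ x, θ < (T - t) * ‖fderiv ℝ (u t) x‖ := by
  have hev : ∀ᶠ t in 𝓝[<] T, t < T := eventually_nhdsWithin_of_forall fun t ht => ht
  refine ((alignedStretching_frequently_gt_of_not_hasSobolevExtensionPast hν hT hsol hreg hmax
    hθ).and_eventually hev).mono fun t ht => ?_
  obtain ⟨⟨x, hx⟩, htT⟩ := ht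
  refine ⟨x, ?_⟩
  have hTt : 0 ≤ T - t := (sub_pos.2 htT).le
  have hω : curl (u t) x ≠ 0 := by
    intro h0
    rw [h0] at hx
    simp at hx
  have hn2 : 0 < ‖curl (u t) x‖ ^ 2 := by positivity
  have hinner : ⟪fderiv ℝ (u t) x (curl (u t) x), curl (u t) x⟫ ≤
      ‖fderiv ℝ (u t) x‖ * ‖curl (u t) x‖ ^ 2 :=
    calc ⟪fderiv ℝ (u t) x (curl (u t) x), curl (u t) x⟫
        ≤ ‖fderiv ℝ (u t) x (curl (u t) x)‖ * ‖curl (u t) x‖ := real_inner_le_norm _ _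
      _ ≤ (‖fderiv ℝ (u t) x‖ * ‖curl (u t) x‖) * ‖curl (u t) x‖ :=
          mul_le_mul_of_nonneg_right (ContinuousLinearMap.le_opNorm _ _) (norm_nonneg _)
      _ = ‖fderiv ℝ (u t) x‖ * ‖curl (u t) x‖ ^ 2 := by ring
  have h1 : θ * ‖curl (u t) x‖ ^ 2 < ((T - t) * ‖fderiv ℝ (u t) x‖) * ‖curl (u t) x‖ ^ 2 := by
    have := mul_le_mul_of_nonneg_left hinner hTt
    linarith
  exact lt_of_mul_lt_mul_right h1 hn2.le

end Summit.NavierStokesRegularity.NavierStokesRegularity.Theorems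

end
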